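import Mathlib
import HarnessLib

/-!
# Route `AnisotropyChord`, crux `ChordXY` (stmt-HubbardSuperconductivity-8146), line `condensate-slab`:
# calculus toolkit for the small-`β` expansion of the slab condensate

Generic analysis used by `stub_slabConcave_smallBeta` (no spin-system content):

* the ENTIRE FUNCTION `ψ(X) = Σ_{n≥0} X^n/(n+1)!` on the matrix algebra `Matrix ι ι ℂ` (L2-operator
  norm), as the sum of the scalar power series `FormalMultilinearSeries.ofScalars` with coefficients
  `1/(n+1)!`: radius `⊤` (`slabPsi_radius_eq_top`), analytic and `C^∞` over `ℝ` (`slabPsi_analyticAt`,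
  `slabPsi_contDiff`), the LINEARISATION IDENTITY `X · ψ(X) = e^X − 1` (`mul_slabPsi_eq_exp_sub_one`) and
  `ψ(0) = 1` (`slabPsi_zero`) — this is what makes `(e^{−βH} − 1)φ = β·y(β)` with `y` smooth in
  `(β, Δ)`, so that no division by `β²` is needed;
* smoothness over `ℝ` of the matrix exponential, of `X ↦ Xφ`, of `w ↦ Bw` and of the sesquilinear
  pairing `⟨f, g⟩ = star f ⬝ᵥ g` (`exp_contDiff_real_matrix`, `contDiff_mulVec_const`,
  `contDiff_const_mulVec`, `contDiff_star_dotProduct`);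
* the second derivative of a `C²` function on `ℝ × ℝ` along the second coordinate is a continuous
  function of the point (`iteratedDeriv_two_curry`, `continuous_iteratedDeriv_two_curry`);
* the second-derivative test on a closed interval for a `C²` function
  (`convexOn_Icc_of_iteratedDeriv_two_nonneg`).

All folklore (Mathlib glue); no definition is introduced; sorry-free.  HONEST: toolkit for a rung stub;
nothing here proves `ChordXY`; superconductivity in the Hubbard model is not advanced.
-/

set_option linter.dupNamespace false

noncomputable section

namespace Summit.HubbardSuperconductivity.HubbardSuperconductivity.Theorems.AnisotropyChord

open scoped Matrix.Norms.L2Operator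
open Matrix Filter Topology FormalMultilinearSeries

section Psi

variable {ι : Type} [Fintype ι] [DecidableEq ι]

/-- The scalar power series `Σ X^n/(n+1)!` has infinite radius of convergence on the matrix algebra
(ratio test: `((n+1)!/(n+2)!) = 1/(n+2) → 0`). [folklore] -/
theorem slabPsi_radius_eq_top :
    (ofScalars (Matrix ι ι ℂ) (fun n => ((Nat.factorial (n + 1) : ℂ))⁻¹)).radius = ⊤ := by
  refine ofScalars_radius_eq_top_of_tendsto (Matrix ι ι ℂ) _ (Eventually.of_forall fun n => ?_) ?_
  · exact inv_ne_zero (by exact_mod_cast (Nat.factorial_ne_zero (n + 1)))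
  · have h : (fun n : ℕ => ‖((Nat.factorial (n.succ + 1) : ℂ))⁻¹‖ / ‖((Nat.factorial (n + 1) : ℂ))⁻¹‖) =
        fun n : ℕ => ((n : ℝ) + 2)⁻¹ := by
      funext n
      rw [norm_inv, norm_inv, Complex.norm_natCast, Complex.norm_natCast, Nat.succ_eq_add_one,
        show n + 1 + 1 = (n + 1) + 1 from rfl, Nat.factorial_succ (n + 1)]
      push_cast
      have hf : ((Nat.factorial (n + 1) : ℕ) : ℝ) ≠ 0 := by exact_mod_cast Nat.factorial_ne_zero _
      field_simp
      ring
    rw [h]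
    exact tendsto_inv_atTop_zero.comp (tendsto_atTop_add_const_right _ _ tendsto_natCast_atTop_atTop)

/-- `ψ(X) = Σ X^n/(n+1)!` is analytic at every matrix. [folklore] -/
theorem slabPsi_analyticAt (X : Matrix ι ι ℂ) :
    AnalyticAt ℂ (ofScalarsSum (E := Matrix ι ι ℂ) (fun n => ((Nat.factorial (n + 1) : ℂ))⁻¹)) X := by
  have hr := slabPsi_radius_eq_top (ι := ι)
  have h := (ofScalars (Matrix ι ι ℂ) (fun n => ((Nat.factorial (n + 1) : ℂ))⁻¹)).hasFPowerSeriesOnBall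
    (by rw [hr]; exact ENNReal.zero_lt_top)
  rw [hr] at h
  exact h.analyticAt_of_mem (by simp)

/-- `ψ` is `C^∞` over `ℝ`. [folklore] -/
theorem slabPsi_contDiff :
    ContDiff ℝ ⊤ (ofScalarsSum (E := Matrix ι ι ℂ) (fun n => ((Nat.factorial (n + 1) : ℂ))⁻¹)) := by
  have h2 : ContDiff ℂ ⊤ (ofScalarsSum (E := Matrix ι ι ℂ) (fun n => ((Nat.factorial (n + 1) : ℂ))⁻¹)) :=
    contDiff_iff_contDiffAt.mpr fun X => (slabPsi_analyticAt X).contDiffAt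
  exact h2.restrict_scalars ℝ

/-- **Linearisation identity** `X · ψ(X) = e^X − 1` (termwise: `X · X^n/(n+1)! = X^{n+1}/(n+1)!`, and
the exponential series without its constant term). [folklore] -/
theorem mul_slabPsi_eq_exp_sub_one (X : Matrix ι ι ℂ) :
    X * ofScalarsSum (E := Matrix ι ι ℂ) (fun n => ((Nat.factorial (n + 1) : ℂ))⁻¹) X =
      NormedSpace.exp X - 1 := by
  have hr := slabPsi_radius_eq_top (ι := ι)
  have h := (ofScalars (Matrix ι ι ℂ) (fun n => ((Nat.factorial (n + 1) : ℂ))⁻¹)).hasFPowerSeriesOnBall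
    (by rw [hr]; exact ENNReal.zero_lt_top)
  have hsum := h.hasSum (y := X) (by rw [hr]; simp)
  rw [zero_add] at hsum
  simp only [ofScalars_apply_eq] at hsum
  have h1 : HasSum (fun n : ℕ => X * (((Nat.factorial (n + 1) : ℂ))⁻¹ • X ^ n))
      (X * ofScalarsSum (E := Matrix ι ι ℂ) (fun n => ((Nat.factorial (n + 1) : ℂ))⁻¹) X) :=
    hsum.mul_left X
  have hexp : HasSum (fun n : ℕ => ((Nat.factorial n : ℂ))⁻¹ • X ^ n) (NormedSpace.exp X) :=
    NormedSpace.exp_series_hasSum_exp' X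
  have hexp1 : HasSum (fun n : ℕ => ((Nat.factorial (n + 1) : ℂ))⁻¹ • X ^ (n + 1))
      (NormedSpace.exp X - 1) := by
    have := (hasSum_nat_add_iff' 1).mpr hexp
    simpa using this
  have heq : (fun n : ℕ => X * (((Nat.factorial (n + 1) : ℂ))⁻¹ • X ^ n)) =
      fun n : ℕ => ((Nat.factorial (n + 1) : ℂ))⁻¹ • X ^ (n + 1) := by
    funext n
    rw [mul_smul_comm, pow_succ']
  rw [heq] at h1
  exact h1.unique hexp1

/-- `ψ(0) = 1`. [folklore] -/
theorem slabPsi_zero :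
    ofScalarsSum (E := Matrix ι ι ℂ) (fun n => ((Nat.factorial (n + 1) : ℂ))⁻¹) 0 = 1 := by
  rw [ofScalarsSum_zero]
  simp

/-- The matrix exponential is `C^∞` over `ℝ` (it is `ℂ`-analytic). [folklore] -/
theorem exp_contDiff_real_matrix : ContDiff ℝ ⊤ (fun X : Matrix ι ι ℂ => NormedSpace.exp X) := by
  have h2 : ContDiff ℂ ⊤ (fun X : Matrix ι ι ℂ => NormedSpace.exp X) :=
    contDiff_iff_contDiffAt.mpr fun X => (NormedSpace.exp_analytic X).contDiffAt
  exact h2.restrict_scalars ℝ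

/-- `X ↦ X φ` is `C^∞` (linear, finite-dimensional). [folklore] -/
theorem contDiff_mulVec_const (φ : ι → ℂ) : ContDiff ℝ ⊤ (fun X : Matrix ι ι ℂ => X *ᵥ φ) := by
  have hL : IsLinearMap ℝ (fun X : Matrix ι ι ℂ => X *ᵥ φ) :=
    ⟨fun X Y => add_mulVec X Y φ, fun c X => by rw [smul_mulVec]⟩
  exact (LinearMap.toContinuousLinearMap (hL.mk' _)).contDiff

omit [DecidableEq ι] in
/-- `w ↦ B w` composed with a `C^n` map is `C^n` (linear, finite-dimensional). [folklore] -/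
theorem contDiff_const_mulVec {E : Type} [NormedAddCommGroup E] [NormedSpace ℝ E] (B : Matrix ι ι ℂ)
    {w : E → ι → ℂ} {n : WithTop ℕ∞} (hw : ContDiff ℝ n w) :
    ContDiff ℝ n (fun p => B *ᵥ w p) := by
  have hL : IsLinearMap ℝ (fun v : ι → ℂ => B *ᵥ v) :=
    ⟨fun u v => mulVec_add B u v, fun c v => by rw [mulVec_smul]⟩
  exact (LinearMap.toContinuousLinearMap (hL.mk' _)).contDiff.comp hw

omit [DecidableEq ι] in
/-- The sesquilinear pairing `p ↦ star (f p) ⬝ᵥ g p` of two `C^n` vector-valued maps is `C^n` over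
`ℝ`. [folklore] -/
theorem contDiff_star_dotProduct {E : Type} [NormedAddCommGroup E] [NormedSpace ℝ E]
    {f g : E → ι → ℂ} {n : WithTop ℕ∞} (hf : ContDiff ℝ n f) (hg : ContDiff ℝ n g) :
    ContDiff ℝ n (fun p => star (f p) ⬝ᵥ g p) := by
  unfold dotProduct
  refine ContDiff.sum fun i _ => ?_
  have hfi : ContDiff ℝ n (fun p => f p i) := contDiff_pi.mp hf i
  have hgi : ContDiff ℝ n (fun p => g p i) := contDiff_pi.mp hg i
  have hstar : ContDiff ℝ n (fun p => star (f p i)) := by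
    have : ContDiff ℝ n (fun z : ℂ => star z) := Complex.conjCLE.contDiff
    exact this.comp hfi
  simpa [Pi.star_apply] using hstar.mul hgi

end Psi

/-! ### Second derivative along the second coordinate -/

/-- For a `C²` function `G` on `ℝ × ℝ`, the second derivative of `Δ ↦ G(β, Δ)` is the second
Fréchet derivative of `G` evaluated twice on the direction `(0,1)`. [folklore] -/
theorem iteratedDeriv_two_curry (G : ℝ × ℝ → ℝ) (hG : ContDiff ℝ 2 G) (β Δ : ℝ) :
    iteratedDeriv 2 (fun Δ' => G (β, Δ')) Δ =
      iteratedFDeriv ℝ 2 G (β, Δ) (fun _ => ((0 : ℝ), (1 : ℝ))) := by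
  have hcomp : (fun Δ' : ℝ => G (β, Δ')) =
      (fun p : ℝ × ℝ => G (p + ((β : ℝ), (0 : ℝ)))) ∘ (ContinuousLinearMap.inr ℝ ℝ ℝ) := by
    funext Δ'
    simp
  rw [iteratedDeriv_eq_iteratedFDeriv, hcomp]
  have hG' : ContDiff ℝ 2 (fun p : ℝ × ℝ => G (p + ((β : ℝ), (0 : ℝ)))) :=
    hG.comp (contDiff_id.add contDiff_const)
  rw [ContinuousLinearMap.iteratedFDeriv_comp_right _ hG' _ le_rfl,
    ContinuousMultilinearMap.compContinuousLinearMap_apply, iteratedFDeriv_comp_add_right]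
  congr 1
  simp

/-- Hence `(β, Δ) ↦ ∂²_Δ G(β, Δ)` is continuous for `G ∈ C²(ℝ × ℝ)`. [folklore] -/
theorem continuous_iteratedDeriv_two_curry (G : ℝ × ℝ → ℝ) (hG : ContDiff ℝ 2 G) :
    Continuous (fun p : ℝ × ℝ => iteratedDeriv 2 (fun Δ' => G (p.1, Δ')) p.2) := by
  have h : (fun p : ℝ × ℝ => iteratedDeriv 2 (fun Δ' => G (p.1, Δ')) p.2) =
      fun p => iteratedFDeriv ℝ 2 G p (fun _ => ((0 : ℝ), (1 : ℝ))) := by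
    funext p
    rw [iteratedDeriv_two_curry G hG p.1 p.2]
  rw [h]
  exact (ContinuousMultilinearMap.apply ℝ (fun _ : Fin 2 => ℝ × ℝ) ℝ
    (fun _ => ((0 : ℝ), (1 : ℝ)))).continuous.comp (hG.continuous_iteratedFDeriv le_rfl)

/-- **Second-derivative test on a closed interval** for a `C²` function: `f'' ≥ 0` on `(a, b)` gives
convexity on `[a, b]`. [folklore] -/
theorem convexOn_Icc_of_iteratedDeriv_two_nonneg (f : ℝ → ℝ) (hf : ContDiff ℝ 2 f) {a b : ℝ}
    (h : ∀ x ∈ Set.Ioo a b, 0 ≤ iteratedDeriv 2 f x) : ConvexOn ℝ (Set.Icc a b) f := by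
  refine convexOn_of_deriv2_nonneg (convex_Icc _ _) hf.continuous.continuousOn
    ((hf.differentiable (by norm_num)).differentiableOn) ?_ ?_
  · have h1 := hf.differentiable_iteratedDeriv 1 (by norm_num)
    rw [iteratedDeriv_one] at h1
    exact h1.differentiableOn
  · intro x hx
    rw [interior_Icc] at hx
    rw [iteratedDeriv_eq_iterate] at h
    exact h x hx

end Summit.HubbardSuperconductivity.HubbardSuperconductivity.Theorems.AnisotropyChord

end
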